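import Mathlib
import HarnessLib
import Summits.ResolutionOfSingularities.ResolutionOfSingularities.Theorems.WildQuotientsWildQuotientResolutionS1aLogExitFramesLocTame
import Literature.AlgebraicGeometry.Resolution.RsopMonomialIdeals

/-!
# Line L exit — part 7 (appendix to v3.1): Δ-ADAPTED homogeneous frames (door rung D2; idea-1 target T2)

[OURS · L1 W4.5c · idea-1 g11, 2026-08-27; plan-1 ★ 23:39:37Z ASSIGNMENT «idea-1 → T2 (Δ-adapted homogeneous r.s.p.,
§8 strengthening) then T1»; memos `L/res-L1-w45c-idea-1/f1/EXIT-DOOR-PLAN.md` fe7d390f95414a93, plan-1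
`L/w45c/EXIT-DOOR-DESIGN.md` v1 §5 (D2 = affine torification lemma)] — NOT statements of the manuscript; counted 0;
AI-written and AI-reviewed only (weaker than expert review). Crux stmt-ResolutionOfSingularities-17941
(`WildQuotients.CyclicQuotientFourfolds`), skeleton line `s1a-logminvertex` v5 (door stub `stub_tameQuotientResolution`).
PART 7 of the helper module (parts 3–6 = `…LocPrep/…LocKato/…LocProof/…LocTame`). No `sorry`, no `instance`, no
`notation`; Literature notions CITED (`LogChart.IsLogRegularLocal`, `invariantSubring`).

WHAT IS ADDED (all REAL, ring level, over parts 3–6):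
* §13a `linearIndependent_toCotangent_of_span` — a family that is part of a MINIMAL generating set of `𝔪_A`
  (`a + c = spanFinrank 𝔪_A` generators) has linearly independent classes in the cotangent space (Mathlib
  `linearIndependent_of_top_le_span_of_card_eq_finrank`); this is the κ-free form of "adapted" used below.
* §13b `exists_homogeneous_generators_extending` — the Δ-ADAPTED form of §8: under (R-triv), given HOMOGENEOUS
  `t : Fin a → B^σ` that are part of a minimal generating set of `𝔪_{B^σ}`, there is a homogeneous minimal generating
  family `s : Fin (spanFinrank 𝔪) → B^σ` (characters `χ`) CONTAINING the `t j` with their prescribed degrees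
  (`∀ j, ∃ i, s i = t j ∧ χ i = τ j`). Proof: extend the classes of the `t j` to a basis inside the image of the
  homogeneous elements (Mathlib `exists_linearIndepOn_id_extension`), lift basis vectors homogeneously, choosing `t j`
  itself over its own class, and conclude by graded Nakayama as in §8.
* §13c `isLogRegularLocal_coneChart` — the log-regularity half of the MASTER lemma (§12) for ANY homogeneous minimal
  generating family `s, χ` of `𝔪_{B^σ}` (`B^σ` regular): the cone chart `P_χ → A₀ = B₀^σ`, `m ↦ s^m`, is log regular
  at the closed point (re-assembly of §9 `nonunitIdeal_coneChart`, §11 `unitFace_coneChart`, §10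
  `ringKrullDim_degZeroInvariants`).
* §13d `exists_logRegular_coneChart_adapted` (MASTER, adapted) and the TAME corollary `f1LocTame_adapted` (`σ = id`,
  `B` regular local, hypothesis Literature `IsRsopPart t`): the frame of §12 / `f1LocTame` can be chosen to CONTAIN
  prescribed homogeneous boundary equations `t j` that are part of a regular system of parameters of `B` — the local
  input of rung D2 (the boundary divisor `Δ = ⋃ V(t j)` becomes a union of facets of the cone chart).
* Companion (independent, over LANDED imports only): `…S1aLogExitFramesDivisorial.lean` — `divisorial_coneChart`
  (idea-1 target T1, Kato 1994 Thm. 11.6 analogue for the cone chart).  Axioms of `f1LocTame_adapted`: `propext`,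
  `Classical.choice`, `Quot.sound`.
-/

set_option linter.dupNamespace false

noncomputable section

open CategoryTheory AlgebraicGeometry TopologicalSpace
open Literature.AlgebraicGeometry.Resolution

namespace Summit.ResolutionOfSingularities.ResolutionOfSingularities.Theorems.WildQuotientResolution.S1.LogExitFrames

/-! ## §13 Δ-adapted homogeneous frames (v3.2) -/

section Adapted

open DirectSum IsLocalRing

/-- **§13a.** In a Noetherian local ring `A`, a family `t : Fin a → A` that is part of a MINIMAL generating set of
`𝔪_A` (together with `c` further generators `u`, `a + c = spanFinrank 𝔪_A`) has linearly independent classes in the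
cotangent space `𝔪_A/𝔪_A²`. [OURS · L1 W4.5c; Mathlib `linearIndependent_of_top_le_span_of_card_eq_finrank`] -/
theorem linearIndependent_toCotangent_of_span {A : Type*} [CommRing A] [IsLocalRing A] [IsNoetherianRing A]
    {a c : ℕ} (t : Fin a → A) (u : Fin c → A) (hac : a + c = (maximalIdeal A).spanFinrank)
    (hspan : Ideal.span (Set.range t ∪ Set.range u) = maximalIdeal A)
    (ht : ∀ j, t j ∈ maximalIdeal A) :
    LinearIndependent (ResidueField A) fun j => (maximalIdeal A).toCotangent ⟨t j, ht j⟩ := by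
  classical
  have hu : ∀ l, u l ∈ maximalIdeal A := fun l => by
    rw [← hspan]
    exact Ideal.subset_span (Or.inr ⟨l, rfl⟩)
  -- the joint family of classes
  let g : Fin a ⊕ Fin c → CotangentSpace A :=
    Sum.elim (fun j => (maximalIdeal A).toCotangent ⟨t j, ht j⟩)
      (fun l => (maximalIdeal A).toCotangent ⟨u l, hu l⟩)
  -- the joint family of lifts spans `𝔪_A` as an `A`-module
  let G : Fin a ⊕ Fin c → maximalIdeal A := Sum.elim (fun j => ⟨t j, ht j⟩) (fun l => ⟨u l, hu l⟩)
  have hGspan : Submodule.span A (Set.range G) = ⊤ := by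
    apply Submodule.map_injective_of_injective (maximalIdeal A).injective_subtype
    rw [Submodule.map_span, Submodule.map_top, Submodule.range_subtype, ← Set.range_comp]
    have hrange : Set.range ((maximalIdeal A).subtype ∘ G) = Set.range t ∪ Set.range u := by
      rw [← Set.Sum.elim_range]
      congr 1
      ext x
      rcases x with j | l <;> rfl
    rw [hrange]
    exact hspan
  have hg : (maximalIdeal A).toCotangent '' Set.range G = Set.range g := by
    rw [← Set.range_comp]
    congr 1
    ext x
    rcases x with j | l <;> rfl
  have hsp : ⊤ ≤ Submodule.span (ResidueField A) (Set.range g) := by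
    rw [← hg, CotangentSpace.span_image_eq_top_iff.mpr hGspan]
  have hcard : Fintype.card (Fin a ⊕ Fin c) = Module.finrank (ResidueField A) (CotangentSpace A) := by
    rw [Fintype.card_sum, Fintype.card_fin, Fintype.card_fin, hac,
      spanFinrank_maximalIdeal_eq_finrank_cotangentSpace]
  have hli : LinearIndependent (ResidueField A) g :=
    linearIndependent_of_top_le_span_of_card_eq_finrank hsp hcard
  exact hli.comp Sum.inl Sum.inl_injective

variable {ι : Type} [DecidableEq ι] [AddCommGroup ι] [Fintype ι] {B : Type} [CommRing B] [IsLocalRing B]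
  (𝒜 : ι → AddSubgroup B) [GradedRing 𝒜] (σ : B ≃+* B)

omit [Fintype ι] in
/-- **§13b (Δ-adapted graded Nakayama).** Under (R-triv), with `A = B^σ` regular local: HOMOGENEOUS elements
`t j ∈ A` (degrees `τ j`) that are part of a minimal generating set of `𝔪_A` extend to a HOMOGENEOUS minimal
generating family `s : Fin (spanFinrank 𝔪_A) → A` (characters `χ`) of `𝔪_A` containing them with their degrees.
[OURS · L1 W4.5c; Mathlib `exists_linearIndepOn_id_extension`, `IsLocalRing.CotangentSpace.span_image_eq_top_iff`] -/
theorem exists_homogeneous_generators_extending [IsRegularLocalRing (invariantSubring σ)]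
    (hσ : ∀ c : ι, ∀ b ∈ 𝒜 c, σ b ∈ 𝒜 c)
    (hR : ∀ c : ι, c ≠ 0 → ∀ b ∈ 𝒜 c, b ∈ maximalIdeal B)
    {a c : ℕ} (t : Fin a → invariantSubring σ) (τ : Fin a → ι)
    (htτ : ∀ j, ((t j : invariantSubring σ) : B) ∈ 𝒜 (τ j))
    (u : Fin c → invariantSubring σ) (hac : a + c = (maximalIdeal (invariantSubring σ)).spanFinrank)
    (htu : Ideal.span (Set.range t ∪ Set.range u) = maximalIdeal (invariantSubring σ)) :
    ∃ (s : Fin (maximalIdeal (invariantSubring σ)).spanFinrank → invariantSubring σ)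
      (χ : Fin (maximalIdeal (invariantSubring σ)).spanFinrank → ι),
      (∀ i, ((s i : invariantSubring σ) : B) ∈ 𝒜 (χ i)) ∧
      Ideal.span (Set.range s) = maximalIdeal (invariantSubring σ) ∧
      ∀ j, ∃ i, s i = t j ∧ χ i = τ j := by
  classical
  set d := (maximalIdeal (invariantSubring σ)).spanFinrank with hddef
  have ht : ∀ j, t j ∈ maximalIdeal (invariantSubring σ) := fun j => by
    rw [← htu]
    exact Ideal.subset_span (Or.inl ⟨j, rfl⟩)
  -- linear independence of the classes of the `t j`
  have hli : LinearIndependent (ResidueField (invariantSubring σ)) fun j => (maximalIdeal (invariantSubring σ)).toCotangent ⟨t j, ht j⟩ :=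
    linearIndependent_toCotangent_of_span t u hac htu ht
  set π : maximalIdeal (invariantSubring σ) →ₗ[(invariantSubring σ)] CotangentSpace (invariantSubring σ) := (maximalIdeal (invariantSubring σ)).toCotangent with hπ
  set H : Set (maximalIdeal (invariantSubring σ)) := {x | ∃ c : ι, ((x : (invariantSubring σ)) : B) ∈ 𝒜 c} with hHdef
  have hH : Submodule.span (invariantSubring σ) H = ⊤ := span_homogeneous_maximalIdeal_eq_top 𝒜 σ hσ hR
  have hHκ : Submodule.span (ResidueField (invariantSubring σ)) (π '' H) = ⊤ :=
    CotangentSpace.span_image_eq_top_iff.mpr hH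
  -- the classes of the `t j` lie in `π '' H` and are independent as a set
  set cl : Fin a → CotangentSpace (invariantSubring σ) := fun j => π ⟨t j, ht j⟩ with hcl
  have hclinj : Function.Injective cl := hli.injective
  have hS₀ : Set.range cl ⊆ π '' H := by
    rintro _ ⟨j, rfl⟩
    exact ⟨⟨t j, ht j⟩, ⟨τ j, htτ j⟩, rfl⟩
  have hli0 : LinearIndepOn (ResidueField (invariantSubring σ)) id (Set.range cl) :=
    (linearIndepOn_id_range_iff hclinj).mpr hli
  -- extend to a basis inside `π '' H`
  obtain ⟨b, hbT, hS₀b, hTb, hbli⟩ := exists_linearIndepOn_id_extension hli0 hS₀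
  have hbli' : LinearIndependent (ResidueField (invariantSubring σ)) ((↑) : b → CotangentSpace (invariantSubring σ)) := hbli
  have hbfin : b.Finite := hbli'.setFinite
  letI : Fintype b := hbfin.fintype
  have hbspan : Submodule.span (ResidueField (invariantSubring σ)) b = ⊤ :=
    top_le_iff.mp (hHκ ▸ Submodule.span_le.mpr hTb)
  have hsp : ⊤ ≤ Submodule.span (ResidueField (invariantSubring σ)) (Set.range ((↑) : b → CotangentSpace (invariantSubring σ))) := by
    rw [Subtype.range_coe, hbspan]
  let bas := Module.Basis.mk hbli' hsp
  have hcard : Fintype.card b = d := by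
    rw [hddef, spanFinrank_maximalIdeal_eq_finrank_cotangentSpace, Module.finrank_eq_card_basis bas]
  let e : Fin d ≃ b := (Fintype.equivFinOfCardEq hcard).symm
  -- homogeneous lifts, choosing `t j` over its own class
  have hch : ∀ v : b, ∃ h : maximalIdeal (invariantSubring σ), h ∈ H ∧ π h = (v : CotangentSpace (invariantSubring σ)) ∧
      ((v : CotangentSpace (invariantSubring σ)) ∈ Set.range cl → ∃ j, cl j = v ∧ (h : (invariantSubring σ)) = t j) := by
    intro v
    by_cases hv : (v : CotangentSpace (invariantSubring σ)) ∈ Set.range cl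
    · obtain ⟨j, hj⟩ := hv
      exact ⟨⟨t j, ht j⟩, ⟨τ j, htτ j⟩, hj, fun _ => ⟨j, hj, rfl⟩⟩
    · obtain ⟨h, hhH, hh⟩ := hbT v.2
      exact ⟨h, hhH, hh, fun h' => absurd h' hv⟩
  choose g hgH hg hgt using hch
  -- degrees: the prescribed `τ j` over the classes of the `t j`, any degree elsewhere
  have hdeg : ∀ v : b, ∃ c' : ι, (((g v : maximalIdeal (invariantSubring σ)) : (invariantSubring σ)) : B) ∈ 𝒜 c' ∧
      ((v : CotangentSpace (invariantSubring σ)) ∈ Set.range cl → ∃ j, cl j = v ∧ (g v : (invariantSubring σ)) = t j ∧ c' = τ j) := by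
    intro v
    by_cases hv : (v : CotangentSpace (invariantSubring σ)) ∈ Set.range cl
    · obtain ⟨j, hj, hgj⟩ := hgt v hv
      refine ⟨τ j, ?_, fun _ => ⟨j, hj, hgj, rfl⟩⟩
      rw [hgj]
      exact htτ j
    · obtain ⟨c', hc'⟩ := hgH v
      exact ⟨c', hc', fun h' => absurd h' hv⟩
  choose deg hdeg hdegt using hdeg
  -- the lifts of a basis generate `𝔪_A` (graded Nakayama, as in §8)
  have hspan' : Submodule.span (invariantSubring σ) (Set.range fun i : Fin d => g (e i)) = ⊤ := by
    apply CotangentSpace.span_image_eq_top_iff.mp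
    have himg : (maximalIdeal (invariantSubring σ)).toCotangent '' Set.range (fun i : Fin d => g (e i)) = b := by
      ext v
      constructor
      · rintro ⟨_, ⟨i, rfl⟩, rfl⟩
        rw [← hπ, hg]
        exact (e i).2
      · intro hv
        refine ⟨g (e (e.symm ⟨v, hv⟩)), ⟨_, rfl⟩, ?_⟩
        rw [← hπ, hg, Equiv.apply_symm_apply]
    rw [himg, hbspan]
  refine ⟨fun i => (g (e i) : (invariantSubring σ)), fun i => deg (e i), fun i => hdeg (e i), ?_, ?_⟩
  · have hmap := congr_arg (Submodule.map (maximalIdeal (invariantSubring σ)).subtype) hspan'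
    rw [Submodule.map_span, Submodule.map_top, Submodule.range_subtype, ← Set.range_comp] at hmap
    exact hmap
  · intro j
    have hjb : cl j ∈ b := hS₀b ⟨j, rfl⟩
    refine ⟨e.symm ⟨cl j, hjb⟩, ?_, ?_⟩
    · obtain ⟨j', hj', hgj'⟩ := hgt (e (e.symm ⟨cl j, hjb⟩)) (by rw [Equiv.apply_symm_apply]; exact ⟨j, rfl⟩)
      rw [Equiv.apply_symm_apply] at hj'
      have hjj : j' = j := hclinj hj'
      show ((g (e (e.symm ⟨cl j, hjb⟩)) : maximalIdeal (invariantSubring σ)) : (invariantSubring σ)) = t j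
      rw [hgj', hjj]
    · obtain ⟨j', hj', -, hc'⟩ := hdegt (e (e.symm ⟨cl j, hjb⟩)) (by rw [Equiv.apply_symm_apply]; exact ⟨j, rfl⟩)
      rw [Equiv.apply_symm_apply] at hj'
      have hjj : j' = j := hclinj hj'
      show deg (e (e.symm ⟨cl j, hjb⟩)) = τ j
      rw [hc', hjj]

/-- **§13c.** The log-regularity half of the MASTER lemma (§12) for ANY homogeneous minimal generating family: with
`A = B^σ` regular local, (R-triv) and `σ` graded, if `s : Fin (spanFinrank 𝔪_A) → A` are homogeneous (characters
`χ`) and generate `𝔪_A`, then `A₀ = B₀^σ` is local and the cone chart `coneChart 𝒜 σ s χ hs : P_χ → A₀`,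
`m ↦ s^m`, is log regular at the closed point (Kato (2.1): Kato ideal `𝔪_{A₀}` by §9, unit face `{0}` by §11,
`dim A₀ = dim A = rank P_χ^gp` by §10/§6). [OURS · L1 W4.5c] -/
theorem isLogRegularLocal_coneChart [IsRegularLocalRing (invariantSubring σ)]
    (hσ : ∀ c : ι, ∀ b ∈ 𝒜 c, σ b ∈ 𝒜 c)
    (hR : ∀ c : ι, c ≠ 0 → ∀ b ∈ 𝒜 c, b ∈ maximalIdeal B)
    (s : Fin (maximalIdeal (invariantSubring σ)).spanFinrank → invariantSubring σ)
    (χ : Fin (maximalIdeal (invariantSubring σ)).spanFinrank → ι)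
    (hs : ∀ i, ((s i : invariantSubring σ) : B) ∈ 𝒜 (χ i))
    (hspan : Ideal.span (Set.range s) = maximalIdeal (invariantSubring σ)) :
    ∃ (_ : IsLocalRing (degZeroInvariants 𝒜 σ)),
      LogChart.IsLogRegularLocal (charCone χ) (coneChart 𝒜 σ s χ hs) := by
  classical
  haveI hA₀ : IsLocalRing (degZeroInvariants 𝒜 σ) := isLocalRing_degZeroInvariants 𝒜 σ hσ
  have hdimA : ringKrullDim (invariantSubring σ) =
      ((maximalIdeal (invariantSubring σ)).spanFinrank : ℕ) :=
    (IsRegularLocalRing.spanFinrank_maximalIdeal (R := invariantSubring σ)).symm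
  refine ⟨hA₀, ?_⟩
  have hI := nonunitIdeal_coneChart 𝒜 σ s χ hσ hR hs hspan
  have hF := unitFace_coneChart 𝒜 σ s χ hσ hs hspan
  rw [LogChart.IsLogRegularLocal, hI, hF]
  have hfield : IsField (degZeroInvariants 𝒜 σ ⧸ maximalIdeal (degZeroInvariants 𝒜 σ)) :=
    (Ideal.Quotient.maximal_ideal_iff_isField_quotient _).mp inferInstance
  refine ⟨?_, ?_⟩
  · letI := Ideal.Quotient.field (maximalIdeal (degZeroInvariants 𝒜 σ))
    infer_instance
  · rw [ringKrullDim_eq_zero_of_isField hfield, zero_add, ringKrullDim_degZeroInvariants 𝒜 σ hσ,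
      hdimA]
    congr 1
    have h0 : Submodule.span ℤ ((fun q : charCone χ =>
        (q : Fin (maximalIdeal (invariantSubring σ)).spanFinrank → ℤ)) ''
          ({0} : Set (charCone χ))) = ⊥ := by
      rw [Set.image_singleton, ZeroMemClass.coe_zero, Submodule.span_zero_singleton]
    rw [h0, finrank_bot, Nat.sub_zero]

end Adapted

/-! ## §13d The adapted MASTER lemma and its TAME corollary -/

section MasterAdapted

open DirectSum IsLocalRing

/-- **MASTER local frame lemma, Δ-adapted.** As §12 `exists_logRegular_coneChart`, with the homogeneous regular
system of parameters `s` chosen to CONTAIN prescribed homogeneous elements `t j ∈ B^σ` (degrees `τ j`) that are part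
of a minimal generating set of `𝔪_{B^σ}` (`a + c = spanFinrank` generators `t, u`). [OURS · L1 W4.5c] -/
theorem exists_logRegular_coneChart_adapted (ι : Type) [AddCommGroup ι] [Fintype ι] [DecidableEq ι]
    (B : Type) [CommRing B] [IsLocalRing B] (𝒜 : ι → AddSubgroup B) [GradedRing 𝒜] (σ : B ≃+* B)
    [IsRegularLocalRing (invariantSubring σ)]
    (hR : ∀ c : ι, c ≠ 0 → ∀ b ∈ 𝒜 c, b ∈ maximalIdeal B) (hσ : ∀ c : ι, ∀ b ∈ 𝒜 c, σ b ∈ 𝒜 c)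
    {a c : ℕ} (t : Fin a → invariantSubring σ) (τ : Fin a → ι)
    (htτ : ∀ j, ((t j : invariantSubring σ) : B) ∈ 𝒜 (τ j))
    (u : Fin c → invariantSubring σ) (hac : a + c = (maximalIdeal (invariantSubring σ)).spanFinrank)
    (htu : Ideal.span (Set.range t ∪ Set.range u) = maximalIdeal (invariantSubring σ)) :
    ∃ (d : ℕ) (s : Fin d → invariantSubring σ) (χ : Fin d → ι),
      (∀ i, ((s i : invariantSubring σ) : B) ∈ 𝒜 (χ i)) ∧
      ringKrullDim (invariantSubring σ) = d ∧
      Ideal.span (Set.range s) = maximalIdeal (invariantSubring σ) ∧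
      (∀ j, ∃ i, s i = t j ∧ χ i = τ j) ∧
      ∃ (_ : IsLocalRing (degZeroInvariants 𝒜 σ))
        (φ : Multiplicative (charCone χ) →* degZeroInvariants 𝒜 σ),
        (∀ m : charCone χ, ((φ (Multiplicative.ofAdd m) : degZeroInvariants 𝒜 σ) : B) =
          ∏ i, ((s i : invariantSubring σ) : B) ^ ((m : Fin d → ℤ) i).toNat) ∧
        LogChart.IsLogRegularLocal (charCone χ) φ := by
  classical
  obtain ⟨s, χ, hs, hspan, hst⟩ :=
    exists_homogeneous_generators_extending 𝒜 σ hσ hR t τ htτ u hac htu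
  obtain ⟨hA₀, hlog⟩ := isLogRegularLocal_coneChart 𝒜 σ hσ hR s χ hs hspan
  have hdimA : ringKrullDim (invariantSubring σ) =
      ((maximalIdeal (invariantSubring σ)).spanFinrank : ℕ) :=
    (IsRegularLocalRing.spanFinrank_maximalIdeal (R := invariantSubring σ)).symm
  exact ⟨_, s, χ, hs, hdimA, hspan, hst, hA₀, coneChart 𝒜 σ s χ hs, fun m => rfl, hlog⟩

/-- **TAME corollary, Δ-adapted** (`σ = id`, `B` regular local): the degree-`0` subring `B₀` of a regular local ring
graded by a finite abelian group with (R-triv) carries the invariant-monomial cone chart of a homogeneous regular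
system of parameters `s` CONTAINING prescribed homogeneous `t j ∈ B` (degrees `τ j`) that are PART OF A REGULAR
SYSTEM OF PARAMETERS of `B` (Literature `IsRsopPart t`, the local shape of `IsStrictNormalCrossingsDivisor`); the
chart is log regular at the closed point. Local input of door rung D2 (boundary `Δ = ⋃ V(t j)` = a union of facets of
the cone chart). [OURS · L1 W4.5c; cites Literature `IsRsopPart`] -/
theorem f1LocTame_adapted (ι : Type) [AddCommGroup ι] [Fintype ι] [DecidableEq ι] (B : Type) [CommRing B]
    [IsRegularLocalRing B] (𝒜 : ι → AddSubgroup B) [GradedRing 𝒜]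
    (hR : ∀ c : ι, c ≠ 0 → ∀ b ∈ 𝒜 c, b ∈ maximalIdeal B)
    {a : ℕ} (t : Fin a → B) (τ : Fin a → ι) (htτ : ∀ j, t j ∈ 𝒜 (τ j)) (ht : IsRsopPart t) :
    ∃ (d : ℕ) (s : Fin d → B) (χ : Fin d → ι), (∀ i, s i ∈ 𝒜 (χ i)) ∧ ringKrullDim B = d ∧
      Ideal.span (Set.range s) = maximalIdeal B ∧ (∀ j, ∃ i, s i = t j ∧ χ i = τ j) ∧
      ∃ (_ : IsLocalRing (SetLike.GradeZero.subring 𝒜))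
        (φ : Multiplicative (charCone χ) →* SetLike.GradeZero.subring 𝒜),
        (∀ m : charCone χ, ((φ (Multiplicative.ofAdd m) : SetLike.GradeZero.subring 𝒜) : B) =
          ∏ i, s i ^ ((m : Fin d → ℤ) i).toNat) ∧
        LogChart.IsLogRegularLocal (charCone χ) φ := by
  classical
  -- unpack `IsRsopPart t`: `c` further generators `u`, `dim B = a + c`
  obtain ⟨-, c, u, hdimB, htu⟩ := ht
  have hac : a + c = (maximalIdeal B).spanFinrank := by
    have h2 := IsRegularLocalRing.spanFinrank_maximalIdeal (R := B)
    rw [hdimB] at h2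
    exact_mod_cast h2.symm
  let e : invariantSubring (RingEquiv.refl B) ≃+* B :=
    (RingEquiv.subringCongr (invariantSubring_refl B)).trans Subring.topEquiv
  have he : ∀ x, e x = (x : B) := fun x => rfl
  haveI hA : IsRegularLocalRing (invariantSubring (RingEquiv.refl B)) :=
    IsRegularLocalRing.of_ringEquiv (R := B) e.symm
  have hσ : ∀ c : ι, ∀ b ∈ 𝒜 c, (RingEquiv.refl B) b ∈ 𝒜 c := fun c b hb => hb
  -- transport the generators along `e`
  let t' : Fin a → invariantSubring (RingEquiv.refl B) := fun j => e.symm (t j)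
  let u' : Fin c → invariantSubring (RingEquiv.refl B) := fun l => e.symm (u l)
  have ht' : ∀ j, ((t' j : invariantSubring (RingEquiv.refl B)) : B) = t j := fun j => by
    rw [← he, RingEquiv.apply_symm_apply]
  have hu' : ∀ l, ((u' l : invariantSubring (RingEquiv.refl B)) : B) = u l := fun l => by
    rw [← he, RingEquiv.apply_symm_apply]
  have htτ' : ∀ j, ((t' j : invariantSubring (RingEquiv.refl B)) : B) ∈ 𝒜 (τ j) := fun j => by
    rw [ht']
    exact htτ j
  have hsf : (maximalIdeal (invariantSubring (RingEquiv.refl B))).spanFinrank = (maximalIdeal B).spanFinrank := by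
    have h1 := IsRegularLocalRing.spanFinrank_maximalIdeal (R := invariantSubring (RingEquiv.refl B))
    have h2 := IsRegularLocalRing.spanFinrank_maximalIdeal (R := B)
    rw [ringKrullDim_eq_of_ringEquiv e, ← h2] at h1
    exact_mod_cast h1
  have hac' : a + c = (maximalIdeal (invariantSubring (RingEquiv.refl B))).spanFinrank := by
    rw [hsf, hac]
  have htu' : Ideal.span (Set.range t' ∪ Set.range u') = maximalIdeal (invariantSubring (RingEquiv.refl B)) := by
    have h1 : (Ideal.span (Set.range t ∪ Set.range u)).map e.symm = (maximalIdeal B).map e.symm := by rw [htu]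
    rw [IsLocalRing.map_ringEquiv_maximalIdeal e.symm, Ideal.map_span, Set.image_union, ← Set.range_comp,
      ← Set.range_comp] at h1
    exact h1
  obtain ⟨d, s, χ, hs, hdim, hspan, hst, hlocA₀, φ, hφ, hlog⟩ :=
    exists_logRegular_coneChart_adapted ι B 𝒜 (RingEquiv.refl B) hR hσ t' τ htτ' u' hac' htu'
  haveI := hlocA₀
  let e₀ : degZeroInvariants 𝒜 (RingEquiv.refl B) ≃+* SetLike.GradeZero.subring 𝒜 :=
    RingEquiv.subringCongr (degZeroInvariants_refl 𝒜)
  have he₀ : ∀ x, ((e₀ x : SetLike.GradeZero.subring 𝒜) : B) = (x : B) := fun x => rfl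
  refine ⟨d, fun i => (s i : B), χ, hs, ?_, ?_, ?_, e₀.isLocalRing, e₀.toMonoidHom.comp φ, ?_, ?_⟩
  · rw [← hdim]
    exact (ringKrullDim_eq_of_ringEquiv e).symm
  · have h1 : (Ideal.span (Set.range s)).map e = (maximalIdeal _).map e := by rw [hspan]
    rw [IsLocalRing.map_ringEquiv_maximalIdeal e, Ideal.map_span, ← Set.range_comp] at h1
    simpa only [Function.comp_def, he] using h1
  · intro j
    obtain ⟨i, hi, hχ⟩ := hst j
    refine ⟨i, ?_, hχ⟩
    show ((s i : invariantSubring (RingEquiv.refl B)) : B) = t j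
    rw [hi, ht']
  · intro m
    show ((e₀ (φ (Multiplicative.ofAdd m)) : SetLike.GradeZero.subring 𝒜) : B) = _
    rw [he₀]
    exact hφ m
  · exact (LogChart.isLogRegularLocal_comp_equiv (charCone χ) φ e₀).mpr hlog

end MasterAdapted

end Summit.ResolutionOfSingularities.ResolutionOfSingularities.Theorems.WildQuotientResolution.S1.LogExitFrames

end
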